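import Mathlib
import HarnessLib
import Literature.NumberTheory.Transcendental.PeriodsWave0
import Literature.Analysis.SpecialFunctions.CotangentMoments
import Literature.NumberTheory.Irrationality.Zudilin2014.SecondTale
import Summits.KontsevichZagierPeriods.Zeta5Search.TwoTaleSechKernel
import Summits.KontsevichZagierPeriods.Zeta5Search.Denom.KernelPolarMoment

/-!
# First-power kernel: the residue step in profile form; the polar moments `∫ sech1/(u+K)^{1,2}`

HONEST FRAMING: systematic search; no irrationality claim unless certified.  Cell pub-zeta5, class `measure`
(fam-measure g5, file U2-2 of the tale-2 decay chain for `Denom.TwoTaleP15Coincidence.DecayT`; design value,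
formalisation pending).  Pure analysis: the only zeta value is the DEFINED constant `zetaValue 2 = Σ n⁻²`.

* **`integral_sech1_residue_step`** — `g` holomorphic of polynomial growth on the closed strip `|Re t − m| ≤ ½` ⟹
  `∫ sech1(y) g(m−½+iy) dy + ∫ sech1(y) g(m+½+iy) dy = 2π·g(m)` (`sech1 = π/cosh πy` is `∓cos(πm)·π/sin πt` on the
  two lines; U2-1's `integral_kernel1_step` applied to `g − g(m)`, plus `∫ sech1 = π`);
* the POLAR MOMENTS `P¹_K(x) = ∫ sech1(y) dy/(x+iy+K)`, `P²_K(x) = ∫ sech1(y) dy/(x+iy+K)²` (`K ∈ ℕ`): unit steps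
  `P^j_K(m−½) + P^j_K(m+½) = 2π/(m+K)^j` (`m ≥ 1`), translation `P^j_{K+1}(x) = P^j_K(x+1)`, and on the line `x = ½`
  `(−1)^K P¹_K(½) = P¹_0(½) − 2π·harmAlt1 K`, **`(−1)^K P²_K(½) = π ζ(2) − 2π·harmAlt2 K`** (Zudilin's alternating
  sums `Σ_{ℓ≤K} (−1)^{ℓ−1}/ℓ^{1,2}`), where `P²_0(½) = 2π Σ_{m≥1} (−1)^{m−1}/m² = π ζ(2)` (`polarLine2_zero_half`: far-line
  decay `‖P²_0(M+½)‖ ≤ π/(M+½)²` and the tree's `tsum_alternating_eq`).  `P¹_0(½)` (`= 2π log 2`) is never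
  evaluated: in [Zudilin2014ZetaTwo, Prop. 3] it is killed by `Σ_k B_k = 0` (U2-3).
-/
noncomputable section

open Complex Set MeasureTheory Filter Topology Finset
open Literature.NumberTheory.Transcendental
open Literature.NumberTheory.Irrationality.Zudilin2014 (harmAlt1 harmAlt2)
open Summit.KontsevichZagierPeriods.Zeta5Search.Denom.KernelStripStep
open Summit.KontsevichZagierPeriods.Zeta5Search.Denom.KernelResidueStep (line_mem_halfStrip)
open Summit.KontsevichZagierPeriods.Zeta5Search.Denom.KernelPolarMoment (half_le_re_add_natCast
  add_natCast_ne_zero norm_inv_add_natCast_le differentiableOn_inv_add_natCast)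
open Summit.KontsevichZagierPeriods.Zeta5Search.TwoTaleSechKernel

namespace Summit.KontsevichZagierPeriods.Zeta5Search.TwoTaleSechMoments

/-! ### The residue step in profile form -/

/-- **The strip step in profile form**: under the hypotheses of `integral_kernel1_step`,
`∫ sech1(y) g(m−½+iy) dy = −∫ sech1(y) g(m+½+iy) dy` (the kernel flips sign between the two lines). -/
theorem integral_sech1_step {g : ℂ → ℂ} {m : ℤ} {A : ℝ} {N : ℕ}
    (hg : DifferentiableOn ℂ g (halfStrip m)) (h0 : g m = 0)
    (hA : ∀ t ∈ halfStrip m, ‖g t‖ ≤ A * (1 + t.im ^ 2) ^ N) :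
    ∫ y : ℝ, ((sech1 y : ℝ) : ℂ) * g ((((m : ℝ) - 1 / 2 : ℝ) : ℂ) + (y : ℂ) * I) =
      -∫ y : ℝ, ((sech1 y : ℝ) : ℂ) * g ((((m : ℝ) + 1 / 2 : ℝ) : ℂ) + (y : ℂ) * I) := by
  have step := integral_kernel1_step hg h0 hA
  simp only [kernel1_line_sub_half, kernel1_line_add_half] at step
  have hc : (Real.cos (Real.pi * m) : ℂ) ≠ 0 := by exact_mod_cast cos_pi_mul_intCast_ne_zero m
  have eL : (fun y : ℝ => ((-Real.cos (Real.pi * m) * sech1 y : ℝ) : ℂ) * g ((((m : ℝ) - 1 / 2 : ℝ) : ℂ) + (y : ℂ) * I)) =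
      fun y : ℝ => -(Real.cos (Real.pi * m) : ℂ) * (((sech1 y : ℝ) : ℂ) * g ((((m : ℝ) - 1 / 2 : ℝ) : ℂ) + (y : ℂ) * I)) := by
    funext y; push_cast; ring
  have eR : (fun y : ℝ => ((Real.cos (Real.pi * m) * sech1 y : ℝ) : ℂ) * g ((((m : ℝ) + 1 / 2 : ℝ) : ℂ) + (y : ℂ) * I)) =
      fun y : ℝ => (Real.cos (Real.pi * m) : ℂ) * (((sech1 y : ℝ) : ℂ) * g ((((m : ℝ) + 1 / 2 : ℝ) : ℂ) + (y : ℂ) * I)) := by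
    funext y; push_cast; ring
  rw [eL, eR, integral_const_mul, integral_const_mul] at step
  have h2 : (Real.cos (Real.pi * m) : ℂ) * (∫ y : ℝ, ((sech1 y : ℝ) : ℂ) * g ((((m : ℝ) - 1 / 2 : ℝ) : ℂ) + (y : ℂ) * I)) =
      (Real.cos (Real.pi * m) : ℂ) * (-∫ y : ℝ, ((sech1 y : ℝ) : ℂ) * g ((((m : ℝ) + 1 / 2 : ℝ) : ℂ) + (y : ℂ) * I)) := by
    rw [mul_neg]
    linear_combination -step
  exact mul_left_cancel₀ hc h2

/-- On a line `Re t = x` of the closed strip, `sech1(y) · g(x+iy)` is integrable. -/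
theorem integrable_sech1_line {g : ℂ → ℂ} {m : ℤ} {A : ℝ} {N : ℕ} (hg : DifferentiableOn ℂ g (halfStrip m))
    (hA : ∀ t ∈ halfStrip m, ‖g t‖ ≤ A * (1 + t.im ^ 2) ^ N) {x : ℝ}
    (hx : x ∈ Icc ((m : ℝ) - 1 / 2) ((m : ℝ) + 1 / 2)) :
    Integrable fun y : ℝ => ((sech1 y : ℝ) : ℂ) * g ((x : ℂ) + (y : ℂ) * I) :=
  integrable_sech1_mul (hg.continuousOn.comp_continuous (by fun_prop) fun y => line_mem_halfStrip hx y)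
    fun y => by simpa using hA _ (line_mem_halfStrip hx y)

/-- **The residue step in profile form.**  For `g` holomorphic of polynomial growth on the closed strip
`|Re t − m| ≤ ½`: `∫ sech1(y) g(m−½+iy) dy + ∫ sech1(y) g(m+½+iy) dy = 2π·g(m)` (the residue of `π g(t)/sin πt` at
the simple pole `t = m` is `cos(πm) g(m)`; the kernel on the two lines is `∓cos(πm)·sech1`). -/
theorem integral_sech1_residue_step {g : ℂ → ℂ} {m : ℤ} {A : ℝ} {N : ℕ}
    (hg : DifferentiableOn ℂ g (halfStrip m)) (hA : ∀ t ∈ halfStrip m, ‖g t‖ ≤ A * (1 + t.im ^ 2) ^ N) :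
    (∫ y : ℝ, ((sech1 y : ℝ) : ℂ) * g ((((m : ℝ) - 1 / 2 : ℝ) : ℂ) + (y : ℂ) * I)) +
      (∫ y : ℝ, ((sech1 y : ℝ) : ℂ) * g ((((m : ℝ) + 1 / 2 : ℝ) : ℂ) + (y : ℂ) * I)) = 2 * Real.pi * g m := by
  -- the remainder `r = g − g(m)` vanishes at `m`
  have hrD : DifferentiableOn ℂ (fun t => g t - g m) (halfStrip m) := hg.sub_const _
  have hr0 : (fun t => g t - g m) m = 0 := by simp
  have hrA : ∀ t ∈ halfStrip m, ‖(fun t => g t - g m) t‖ ≤ (A + ‖g m‖) * (1 + t.im ^ 2) ^ N := by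
    intro t ht
    have hq : (1 : ℝ) ≤ (1 + t.im ^ 2) ^ N := one_le_pow₀ (by nlinarith [sq_nonneg t.im])
    calc ‖g t - g m‖ ≤ ‖g t‖ + ‖g m‖ := norm_sub_le _ _
      _ ≤ A * (1 + t.im ^ 2) ^ N + ‖g m‖ * (1 + t.im ^ 2) ^ N :=
          add_le_add (hA t ht) (le_mul_of_one_le_right (norm_nonneg _) hq)
      _ = (A + ‖g m‖) * (1 + t.im ^ 2) ^ N := by ring
  have step := integral_sech1_step hrD hr0 hrA
  beta_reduce at step
  -- integrability of the pieces on the two lines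
  have IrL : Integrable fun y : ℝ => ((sech1 y : ℝ) : ℂ) * (g ((((m : ℝ) - 1 / 2 : ℝ) : ℂ) + (y : ℂ) * I) - g m) :=
    integrable_sech1_line hrD hrA ⟨le_rfl, by linarith⟩
  have IrR : Integrable fun y : ℝ => ((sech1 y : ℝ) : ℂ) * (g ((((m : ℝ) + 1 / 2 : ℝ) : ℂ) + (y : ℂ) * I) - g m) :=
    integrable_sech1_line hrD hrA ⟨by linarith, le_rfl⟩
  have I0 : Integrable fun y : ℝ => ((sech1 y : ℝ) : ℂ) := integrable_sech1.ofReal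
  have Ic : ∫ y : ℝ, ((sech1 y : ℝ) : ℂ) = Real.pi := by
    rw [integral_complex_ofReal, integral_sech1]
  -- decompose both line integrals: `∫ sech1·g = ∫ sech1·r + g(m)·π`
  have eqL : ∫ y : ℝ, ((sech1 y : ℝ) : ℂ) * g ((((m : ℝ) - 1 / 2 : ℝ) : ℂ) + (y : ℂ) * I) =
      (∫ y : ℝ, ((sech1 y : ℝ) : ℂ) * (g ((((m : ℝ) - 1 / 2 : ℝ) : ℂ) + (y : ℂ) * I) - g m)) + g m * Real.pi := by
    rw [← Ic, ← integral_const_mul, ← integral_add IrL (I0.const_mul _)]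
    congr 1; funext y; ring
  have eqR : ∫ y : ℝ, ((sech1 y : ℝ) : ℂ) * g ((((m : ℝ) + 1 / 2 : ℝ) : ℂ) + (y : ℂ) * I) =
      (∫ y : ℝ, ((sech1 y : ℝ) : ℂ) * (g ((((m : ℝ) + 1 / 2 : ℝ) : ℂ) + (y : ℂ) * I) - g m)) + g m * Real.pi := by
    rw [← Ic, ← integral_const_mul, ← integral_add IrR (I0.const_mul _)]
    congr 1; funext y; ring
  rw [eqL, eqR, step]
  ring

/-! ### The polar test functions `1/(t+K)^j` on the strips `|Re t − m| ≤ ½`, `m ≥ 1` -/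

/-- `‖1/(t+K)²‖ ≤ 4` on `halfStrip m`, `m ≥ 1` (growth exponent `0`). -/
theorem norm_inv_add_natCast_sq_le {m K : ℕ} (hm : 1 ≤ m) :
    ∀ t ∈ halfStrip (m : ℤ), ‖1 / (t + K) ^ 2‖ ≤ 4 * (1 + t.im ^ 2) ^ 0 := by
  intro t ht
  have h := norm_inv_add_natCast_le (k := K) hm t ht
  rw [pow_zero, mul_one] at h ⊢
  rw [norm_div, norm_one, norm_pow, ← one_div_pow]
  rw [norm_div, norm_one] at h
  nlinarith [h, norm_nonneg (1 / (t + (K : ℂ))), div_nonneg zero_le_one (norm_nonneg (t + (K : ℂ)))]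

/-- `1/(t+K)²` is holomorphic on `halfStrip m`, `m ≥ 1`. -/
theorem differentiableOn_inv_add_natCast_sq {m : ℕ} (hm : 1 ≤ m) (K : ℕ) :
    DifferentiableOn ℂ (fun t : ℂ => 1 / (t + K) ^ 2) (halfStrip (m : ℤ)) := by
  have hden : ∀ t ∈ halfStrip (m : ℤ), (t + (K : ℂ)) ^ 2 ≠ 0 := fun t ht => pow_ne_zero _ (add_natCast_ne_zero hm ht)
  fun_prop (disch := first | assumption | exact hden)

/-! ### The polar moments -/

/-- `P¹_K(x) = ∫ sech1(y) dy/(x + iy + K)`. -/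
def polarLine1 (K : ℕ) (x : ℝ) : ℂ := ∫ y : ℝ, ((sech1 y : ℝ) : ℂ) * (1 / ((x : ℂ) + (y : ℂ) * I + K))

/-- `P²_K(x) = ∫ sech1(y) dy/(x + iy + K)²`. -/
def polarLine2 (K : ℕ) (x : ℝ) : ℂ := ∫ y : ℝ, ((sech1 y : ℝ) : ℂ) * (1 / ((x : ℂ) + (y : ℂ) * I + K) ^ 2)

/-- Unit step of `P¹`: `P¹_K(m−½) + P¹_K(m+½) = 2π/(m+K)` (`m ≥ 1`). -/
theorem polarLine1_step {m : ℕ} (hm : 1 ≤ m) (K : ℕ) :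
    polarLine1 K ((m : ℝ) - 1 / 2) + polarLine1 K ((m : ℝ) + 1 / 2) = 2 * Real.pi / ((m : ℂ) + K) := by
  have step := integral_sech1_residue_step (differentiableOn_inv_add_natCast hm K)
    (norm_inv_add_natCast_le (k := K) hm)
  simp only [Int.cast_natCast] at step
  unfold polarLine1
  rw [step]
  ring

/-- Unit step of `P²`: `P²_K(m−½) + P²_K(m+½) = 2π/(m+K)²` (`m ≥ 1`). -/
theorem polarLine2_step {m : ℕ} (hm : 1 ≤ m) (K : ℕ) :
    polarLine2 K ((m : ℝ) - 1 / 2) + polarLine2 K ((m : ℝ) + 1 / 2) = 2 * Real.pi / ((m : ℂ) + K) ^ 2 := by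
  have step := integral_sech1_residue_step (differentiableOn_inv_add_natCast_sq hm K)
    (norm_inv_add_natCast_sq_le (K := K) hm)
  simp only [Int.cast_natCast] at step
  unfold polarLine2
  rw [step]
  ring

/-- Translation: `P¹_{K+1}(x) = P¹_K(x+1)`. -/
theorem polarLine1_succ (K : ℕ) (x : ℝ) : polarLine1 (K + 1) x = polarLine1 K (x + 1) := by
  unfold polarLine1; congr 1; funext y; push_cast; ring

/-- Translation: `P²_{K+1}(x) = P²_K(x+1)`. -/
theorem polarLine2_succ (K : ℕ) (x : ℝ) : polarLine2 (K + 1) x = polarLine2 K (x + 1) := by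
  unfold polarLine2; congr 1; funext y; push_cast; ring

/-- `harmAlt1 (K+1) = harmAlt1 K + (−1)^K/(K+1)`. -/
theorem harmAlt1_succ (K : ℕ) : (harmAlt1 (K + 1) : ℂ) = harmAlt1 K + (-1) ^ K / ((K : ℂ) + 1) := by
  simp [harmAlt1, sum_range_succ]

/-- `harmAlt2 (K+1) = harmAlt2 K + (−1)^K/(K+1)²`. -/
theorem harmAlt2_succ (K : ℕ) : (harmAlt2 (K + 1) : ℂ) = harmAlt2 K + (-1) ^ K / ((K : ℂ) + 1) ^ 2 := by
  simp [harmAlt2, sum_range_succ]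

/-- **Closed form on the line `½`**: `(−1)^K P¹_K(½) = P¹_0(½) − 2π·harmAlt1 K`. -/
theorem polarLine1_half_closed (K : ℕ) :
    (-1 : ℂ) ^ K * polarLine1 K (1 / 2) = polarLine1 0 (1 / 2) - 2 * Real.pi * (harmAlt1 K : ℂ) := by
  induction K with
  | zero => simp [harmAlt1]
  | succ K ih =>
    have hstep := polarLine1_step (m := 1) le_rfl K
    rw [show ((1 : ℕ) : ℝ) - 1 / 2 = 1 / 2 by norm_num, show ((1 : ℕ) : ℝ) + 1 / 2 = 1 / 2 + 1 by norm_num,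
      ← polarLine1_succ] at hstep
    rw [harmAlt1_succ, pow_succ]
    push_cast at hstep ⊢
    linear_combination ih - (-1 : ℂ) ^ K * hstep

/-! ### The value `P²_0(½) = π ζ(2)` -/

/-- Iterating the step: `P²_0(½) = (−1)^M P²_0(M+½) + 2π Σ_{j<M} (−1)^j/(j+1)²`. -/
theorem polarLine2_zero_half_eq_sum (M : ℕ) :
    polarLine2 0 (1 / 2) = (-1 : ℂ) ^ M * polarLine2 0 ((M : ℝ) + 1 / 2) +
      2 * Real.pi * ∑ j ∈ range M, (-1 : ℂ) ^ j / ((j : ℂ) + 1) ^ 2 := by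
  induction M with
  | zero => simp
  | succ M ih =>
    have h := polarLine2_step (m := M + 1) (by omega) 0
    have e : ((M + 1 : ℕ) : ℝ) - 1 / 2 = (M : ℝ) + 1 / 2 := by push_cast; ring
    rw [e] at h
    rw [ih, sum_range_succ, pow_succ]
    push_cast at h ⊢
    simp only [add_zero] at h
    linear_combination (-1 : ℂ) ^ M * h

/-- The far lines decay: `‖P²_0(M+½)‖ ≤ π/(M+½)²`. -/
theorem norm_polarLine2_zero_le (M : ℕ) : ‖polarLine2 0 ((M : ℝ) + 1 / 2)‖ ≤ Real.pi / ((M : ℝ) + 1 / 2) ^ 2 := by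
  have hpos : (0 : ℝ) < (M : ℝ) + 1 / 2 := by positivity
  unfold polarLine2
  have hb : ∀ y : ℝ, ‖((sech1 y : ℝ) : ℂ) * (1 / ((((M : ℝ) + 1 / 2 : ℝ) : ℂ) + (y : ℂ) * I + ((0 : ℕ) : ℂ)) ^ 2)‖ ≤
      sech1 y * (1 / ((M : ℝ) + 1 / 2) ^ 2) := by
    intro y
    rw [norm_mul, Complex.norm_real, Real.norm_eq_abs, abs_of_nonneg (sech1_nonneg y), norm_div, norm_one,
      norm_pow]
    refine mul_le_mul_of_nonneg_left ?_ (sech1_nonneg y)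
    have hre : ((((M : ℝ) + 1 / 2 : ℝ) : ℂ) + (y : ℂ) * I + ((0 : ℕ) : ℂ)).re = (M : ℝ) + 1 / 2 := by simp
    have hn := Complex.re_le_norm ((((M : ℝ) + 1 / 2 : ℝ) : ℂ) + (y : ℂ) * I + ((0 : ℕ) : ℂ))
    rw [hre] at hn
    exact one_div_le_one_div_of_le (by positivity) (pow_le_pow_left₀ hpos.le hn 2)
  refine (norm_integral_le_of_norm_le ((integrable_sech1.mul_const _)) (Eventually.of_forall hb)).trans ?_
  rw [integral_mul_const, integral_sech1]
  exact le_of_eq (by ring)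

/-- `(−1)^M P²_0(M+½) → 0`. -/
theorem tendsto_polarLine2_zero :
    Tendsto (fun M : ℕ => (-1 : ℂ) ^ M * polarLine2 0 ((M : ℝ) + 1 / 2)) atTop (𝓝 0) := by
  rw [tendsto_zero_iff_norm_tendsto_zero]
  have h1 : Tendsto (fun M : ℕ => ((M : ℝ) + 1 / 2) ^ 2) atTop atTop :=
    (tendsto_pow_atTop two_ne_zero).comp (tendsto_atTop_add_const_right _ _ tendsto_natCast_atTop_atTop)
  have h2 : Tendsto (fun M : ℕ => Real.pi / ((M : ℝ) + 1 / 2) ^ 2) atTop (𝓝 0) :=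
    tendsto_const_nhds.div_atTop h1
  refine squeeze_zero (fun _ => norm_nonneg _) (fun M => ?_) h2
  rw [norm_mul, norm_pow, norm_neg, norm_one, one_pow, one_mul]
  exact norm_polarLine2_zero_le M

/-- **`P²_0(½) = 2π Σ_{j≥0} (−1)^j/(j+1)²`** as a convergent series. -/
theorem polarLine2_zero_half_hasSum :
    HasSum (fun j : ℕ => 2 * (Real.pi : ℂ) * ((-1 : ℂ) ^ j / ((j : ℂ) + 1) ^ 2)) (polarLine2 0 (1 / 2)) := by
  have hsR : Summable fun j : ℕ => (1 : ℝ) / ((j : ℝ) + 1) ^ 2 :=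
    Literature.Analysis.SpecialFunctions.summable_one_div_succ_pow le_rfl
  have hsC : Summable fun j : ℕ => 2 * (Real.pi : ℂ) * ((-1 : ℂ) ^ j / ((j : ℂ) + 1) ^ 2) := by
    refine Summable.of_norm ?_
    refine (hsR.mul_left (2 * Real.pi)).congr fun j => ?_
    rw [norm_mul, norm_div, norm_pow, norm_neg, norm_one, one_pow, norm_pow, norm_mul, Complex.norm_real,
      Real.norm_eq_abs, abs_of_pos Real.pi_pos]
    have : ‖(j : ℂ) + 1‖ = (j : ℝ) + 1 := by
      rw [show (j : ℂ) + 1 = (((j : ℝ) + 1 : ℝ) : ℂ) by push_cast; ring, Complex.norm_real, Real.norm_eq_abs,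
        abs_of_pos (by positivity)]
    rw [this]
    norm_num
  have ht := hsC.hasSum.tendsto_sum_nat
  have hps : (fun M : ℕ => ∑ j ∈ range M, 2 * (Real.pi : ℂ) * ((-1 : ℂ) ^ j / ((j : ℂ) + 1) ^ 2)) =
      fun M : ℕ => polarLine2 0 (1 / 2) - (-1 : ℂ) ^ M * polarLine2 0 ((M : ℝ) + 1 / 2) := by
    funext M
    rw [polarLine2_zero_half_eq_sum M, mul_sum]
    ring
  rw [hps] at ht
  have hlim : Tendsto (fun M : ℕ => polarLine2 0 (1 / 2) - (-1 : ℂ) ^ M * polarLine2 0 ((M : ℝ) + 1 / 2)) atTop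
      (𝓝 (polarLine2 0 (1 / 2) - 0)) := tendsto_const_nhds.sub tendsto_polarLine2_zero
  rw [sub_zero] at hlim
  rw [← tendsto_nhds_unique ht hlim]
  exact hsC.hasSum

/-- `Σ_{j≥0} (−1)^j/(j+1)² = ζ(2)/2` (`η(2) = (1 − 2^{1−2}) ζ(2)`, the tree's `tsum_alternating_eq`). -/
theorem tsum_alternating_sq_eq : ∑' j : ℕ, (-1 : ℝ) ^ j / ((j : ℝ) + 1) ^ 2 = zetaValue 2 / 2 := by
  have h := Literature.Analysis.SpecialFunctions.tsum_alternating_eq (s := 2) le_rfl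
  have hneg : (fun m : ℕ => (-1 : ℝ) ^ (m + 1) / ((m : ℝ) + 1) ^ 2) =
      fun m : ℕ => -((-1 : ℝ) ^ m / ((m : ℝ) + 1) ^ 2) := by
    funext m; rw [pow_succ]; ring
  rw [hneg, tsum_neg] at h
  have hz : zetaValue 2 = ∑' m : ℕ, 1 / ((m : ℝ) + 1) ^ 2 := by
    rw [zetaValue, (Real.summable_one_div_nat_pow.mpr one_lt_two).tsum_eq_zero_add]
    push_cast
    simp
  rw [show (1 : ℝ) - 2 / 2 ^ 2 = 1 / 2 by norm_num] at h
  rw [hz]; linarith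

/-- **`P²_0(½) = π ζ(2)`.** -/
theorem polarLine2_zero_half : polarLine2 0 (1 / 2) = Real.pi * zetaValue 2 := by
  rw [← polarLine2_zero_half_hasSum.tsum_eq, tsum_mul_left]
  have hc : ∑' j : ℕ, (-1 : ℂ) ^ j / ((j : ℂ) + 1) ^ 2 = (((zetaValue 2 / 2 : ℝ)) : ℂ) := by
    rw [← tsum_alternating_sq_eq, Complex.ofReal_tsum]
    congr 1; funext j; push_cast; ring
  rw [hc]; push_cast; ring

/-- **Closed form on the line `½`, second moments**: `(−1)^K P²_K(½) = π ζ(2) − 2π·harmAlt2 K`. -/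
theorem polarLine2_half_closed (K : ℕ) :
    (-1 : ℂ) ^ K * polarLine2 K (1 / 2) = Real.pi * zetaValue 2 - 2 * Real.pi * (harmAlt2 K : ℂ) := by
  induction K with
  | zero => rw [pow_zero, one_mul, polarLine2_zero_half]; simp [harmAlt2]
  | succ K ih =>
    have hstep := polarLine2_step (m := 1) le_rfl K
    rw [show ((1 : ℕ) : ℝ) - 1 / 2 = 1 / 2 by norm_num, show ((1 : ℕ) : ℝ) + 1 / 2 = 1 / 2 + 1 by norm_num,
      ← polarLine2_succ] at hstep
    rw [harmAlt2_succ, pow_succ]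
    push_cast at hstep ⊢
    linear_combination ih - (-1 : ℂ) ^ K * hstep

end Summit.KontsevichZagierPeriods.Zeta5Search.TwoTaleSechMoments

end
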